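import Mathlib
import Literature.RingTheory.CohomologyAnnihilator.RegularLocalRing
import Literature.RingTheory.CohomologyAnnihilator.Localization
import Literature.AlgebraicGeometry.Resolution.RegularLocalRingsNormal
import Literature.AlgebraicGeometry.Resolution.RankOneReductionProofs
import Summits.ResolutionOfSingularities.ResolutionOfSingularities.Theorems.SyzygyFlatteningHigherRankTerminationEssFiniteType
import HarnessLib

/-!
# Crux `Persistence` (stmt-ResolutionOfSingularities-16484), line `birth` — inverting a
cohomology annihilator: `B[x⁻¹]` is regular and normal (helpers for the core stub
`stub_normalisedChartPersistence`)

Route `ResolutionOfSingularities/HomologicalConductor`. For a `k`-subalgebra `C` of a field `K`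
and `0 ≠ x ∈ C`, `C[x⁻¹] = k[C ∪ {x⁻¹}]` is, through the inclusion, the localisation of `C` away
from `x` (`isLocalization_away_adjoin_inv`). Consequences, with `ca` the Iyengar–Takahashi
cohomology annihilator ideal `Literature.RingTheory.CohomologyAnnihilator.cohomologyAnnihilator`:

* if `B` is noetherian and `x ∈ ca B` (image in `K`), then `ca (B[x⁻¹]) = ⊤` — `x` stays an
  annihilator in the localisation (Iyengar–Takahashi 2014, Lemma 2.10(1), tree
  `algebraMap_mem_cohomologyAnnihilator_of_isLocalization`) and becomes a unit
  (`cohomologyAnnihilator_adjoin_inv_eq_top`);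
* a noetherian ring with `ca = ⊤` has `ca = ⊤` in every localisation, is a regular local ring at
  every prime (Auslander–Buchsbaum–Serre, tree `isRegularLocalRing_of_cohomologyAnnihilator_eq_top`)
  and, if a domain, is integrally closed (Matsumura 19.4 for regular local rings, tree
  `isIntegrallyClosed_of_isRegularLocalRing`, plus the local nature of integral closedness):
  `isIntegrallyClosed_of_cohomologyAnnihilator_eq_top`; so `nrm (B[x⁻¹]) = B[x⁻¹]` when
  `Frac B = K` (`nrm_adjoin_inv_eq_self`, `nrm` = the route's normalisation inside `K`);
* **regular off `V(x)`** (abstract form): if `C[x⁻¹]` is noetherian with `ca (C[x⁻¹]) = ⊤`, then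
  `C_Q` is a regular local ring for every prime `Q` of `C` with `x ∉ Q` — `C_Q` is a localisation
  of `C[x⁻¹]` (`isRegularLocalRing_localization_atPrime_of_adjoin_inv`).

The companion file `HomologicalConductorPersistenceRegularOffCentre.lean` applies this to the
normalised affine `ca`-chart `C = nrm (B[ca B/x])` of the stub (`Sing C ⊆ V(x)`, radical
persistence).

References: S. B. Iyengar, R. Takahashi, *Annihilation of cohomology and strong generation of
module categories*, IMRN 2016, Lemma 2.10 [`IyengarTakahashi2014`]; H. Matsumura,
*Commutative Ring Theory*, Thm. 19.4 [`Matsumura1987`].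
-/

-- single-problem summit: the doubled namespace component is forced
set_option linter.dupNamespace false

noncomputable section

namespace Summit.ResolutionOfSingularities.ResolutionOfSingularities.Theorems.HomologicalConductor.PersistenceAdjoinInv

open Literature.RingTheory.CohomologyAnnihilator
open Literature.AlgebraicGeometry.Resolution
  (isIntegrallyClosed_of_isRegularLocalRing isFractionRing_subalgebra_of_le)
open Summit.ResolutionOfSingularities.ResolutionOfSingularities.Theorems.SyzygyFlattening
  (nrm mem_nrm_iff self_le_nrm)

/-! ## Rings with `ca = ⊤`: localisations, regularity at primes, normality -/

section caTop

/-- If `ca R = R` for a noetherian ring `R`, then `ca R' = R'` for every localisation `R'` of `R`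
(Iyengar–Takahashi, Lemma 2.10(1): `ca(R) R' ⊆ ca(R')`). [cite: IyengarTakahashi2014, Lemma 2.10(1)] -/
theorem cohomologyAnnihilator_eq_top_of_isLocalization {R : Type} [CommRing R] [IsNoetherianRing R]
    (U : Submonoid R) (R' : Type) [CommRing R'] [Algebra R R'] [IsLocalization U R']
    (h : cohomologyAnnihilator R = ⊤) : cohomologyAnnihilator R' = ⊤ := by
  have hle := map_cohomologyAnnihilator_le_of_isLocalization U R'
  rw [h, Ideal.map_top] at hle
  exact eq_top_iff.mpr hle

/-- If `ca R = R` for a noetherian ring `R`, then every localisation of `R` at a prime is a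
regular local ring (`ca = ⊤` persists to the localisation, and a noetherian local ring with
`ca = ⊤` is regular, Auslander–Buchsbaum–Serre). [cite: IyengarTakahashi2014, Lemma 2.10] -/
theorem isRegularLocalRing_of_isLocalization_atPrime_of_cohomologyAnnihilator_eq_top {R : Type}
    [CommRing R] [IsNoetherianRing R] (h : cohomologyAnnihilator R = ⊤) (P : Ideal R) [P.IsPrime]
    (R' : Type) [CommRing R'] [Algebra R R'] [IsLocalization.AtPrime R' P] :
    IsRegularLocalRing R' := by
  haveI : IsNoetherianRing R' := IsLocalization.isNoetherianRing P.primeCompl R' inferInstance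
  haveI : IsLocalRing R' := IsLocalization.AtPrime.isLocalRing R' P
  exact isRegularLocalRing_of_cohomologyAnnihilator_eq_top
    (cohomologyAnnihilator_eq_top_of_isLocalization P.primeCompl R' h)

/-- A noetherian domain with `ca R = R` is integrally closed: it is regular at every maximal
ideal, regular local rings are integrally closed (Matsumura 19.4, tree
`isIntegrallyClosed_of_isRegularLocalRing`), and integral closedness is a local property.
[cite: Matsumura1987, Thm. 19.4] -/
theorem isIntegrallyClosed_of_cohomologyAnnihilator_eq_top {R : Type} [CommRing R] [IsDomain R]
    [IsNoetherianRing R] (h : cohomologyAnnihilator R = ⊤) : IsIntegrallyClosed R := by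
  refine IsIntegrallyClosed.of_localization_maximal fun P _ _ => ?_
  haveI : IsRegularLocalRing (Localization.AtPrime P) :=
    isRegularLocalRing_of_isLocalization_atPrime_of_cohomologyAnnihilator_eq_top h P _
  exact isIntegrallyClosed_of_isRegularLocalRing (Localization.AtPrime P)

end caTop

/-! ## `B[x⁻¹]` inside `K` is the localisation away from `x` -/

variable {k K : Type} [Field k] [Field K] [Algebra k K]

/-- The set `{t⁻¹ | t ∈ {x}}` of the tree's "adjoin inverses" statements is `{x⁻¹}`. [folklore] -/
theorem setOf_inv_mem_singleton (x : K) : {y : K | ∃ t ∈ ({x} : Set K), y = t⁻¹} = {x⁻¹} := by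
  ext y
  simp

/-- `C ≤ C[x⁻¹] = k[C ∪ {x⁻¹}]`. [folklore] -/
theorem le_adjoin_inv (C : Subalgebra k K) (x : K) : C ≤ Algebra.adjoin k ((C : Set K) ∪ {x⁻¹}) :=
  fun _ hy => Algebra.subset_adjoin (Or.inl hy)

/-- `x⁻¹ ∈ C[x⁻¹]`. [folklore] -/
theorem inv_mem_adjoin_inv (C : Subalgebra k K) (x : K) :
    x⁻¹ ∈ Algebra.adjoin k ((C : Set K) ∪ {x⁻¹}) :=
  Algebra.subset_adjoin (Or.inr rfl)

/-- Every element of `C[x⁻¹]` (`x ∈ C`, `x ≠ 0`) is `c * (x ^ n)⁻¹` with `c ∈ C` (induction on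
`Algebra.adjoin`). [folklore] -/
theorem exists_eq_mul_pow_inv_of_mem_adjoin_inv (C : Subalgebra k K) {x : K} (hx : x ∈ C)
    (hx0 : x ≠ 0) {y : K} (hy : y ∈ Algebra.adjoin k ((C : Set K) ∪ {x⁻¹})) :
    ∃ c ∈ C, ∃ n : ℕ, y = c * (x ^ n)⁻¹ := by
  have h1 : ∀ c ∈ C, ∃ c' ∈ C, ∃ n : ℕ, c = c' * (x ^ n)⁻¹ :=
    fun c hc => ⟨c, hc, 0, by rw [pow_zero, inv_one, mul_one]⟩
  induction hy using Algebra.adjoin_induction with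
  | mem z hz =>
    rcases hz with hzC | hzx
    · exact h1 z hzC
    · rw [Set.mem_singleton_iff] at hzx
      exact ⟨1, C.one_mem, 1, by rw [hzx, pow_one, one_mul]⟩
  | algebraMap r => exact h1 _ (C.algebraMap_mem r)
  | add y z _ _ hy hz =>
    obtain ⟨c₁, hc₁, n₁, rfl⟩ := hy
    obtain ⟨c₂, hc₂, n₂, rfl⟩ := hz
    refine ⟨c₁ * x ^ n₂ + c₂ * x ^ n₁, C.add_mem (C.mul_mem hc₁ (C.pow_mem hx _))
      (C.mul_mem hc₂ (C.pow_mem hx _)), n₁ + n₂, ?_⟩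
    have h1' : (x ^ n₁) ≠ 0 := pow_ne_zero _ hx0
    have h2' : (x ^ n₂) ≠ 0 := pow_ne_zero _ hx0
    rw [pow_add]
    field_simp
  | mul y z _ _ hy hz =>
    obtain ⟨c₁, hc₁, n₁, rfl⟩ := hy
    obtain ⟨c₂, hc₂, n₂, rfl⟩ := hz
    refine ⟨c₁ * c₂, C.mul_mem hc₁ hc₂, n₁ + n₂, ?_⟩
    rw [pow_add, mul_inv]
    ring

/-- **`C[x⁻¹]` is the localisation of `C` away from `x`** (`x ∈ C`, `x ≠ 0`), through the
inclusion `C ≤ C[x⁻¹]`: `x` becomes a unit, every element is `c * (x ^ n)⁻¹`, and `C → K` is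
injective. [folklore] -/
theorem isLocalization_away_adjoin_inv (C : Subalgebra k K) {x : K} (hx : x ∈ C) (hx0 : x ≠ 0) :
    @IsLocalization.Away ↥C _ (⟨x, hx⟩ : ↥C) ↥(Algebra.adjoin k ((C : Set K) ∪ {x⁻¹})) _
      (Subalgebra.inclusion (le_adjoin_inv C x)).toRingHom.toAlgebra := by
  letI : Algebra ↥C ↥(Algebra.adjoin k ((C : Set K) ∪ {x⁻¹})) :=
    (Subalgebra.inclusion (le_adjoin_inv C x)).toRingHom.toAlgebra
  refine (isLocalization_iff _ _).mpr ⟨?_, fun y => ?_, fun {a b} hab => ?_⟩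
  · rintro ⟨s, n, rfl⟩
    refine IsUnit.of_mul_eq_one ⟨(x ^ n)⁻¹, ?_⟩ (Subtype.ext ?_)
    · rw [← inv_pow]
      exact Subalgebra.pow_mem _ (inv_mem_adjoin_inv C x) n
    · change (x ^ n : K) * (x ^ n)⁻¹ = 1
      exact mul_inv_cancel₀ (pow_ne_zero _ hx0)
  · obtain ⟨c, hc, n, hy⟩ := exists_eq_mul_pow_inv_of_mem_adjoin_inv C hx hx0 y.2
    refine ⟨(⟨c, hc⟩, ⟨⟨x, hx⟩ ^ n, n, rfl⟩), Subtype.ext ?_⟩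
    change (y : K) * (x ^ n : K) = c
    rw [hy, inv_mul_cancel_right₀ (pow_ne_zero _ hx0)]
  · have hab' : (a : K) = b := congrArg (fun t : ↥(Algebra.adjoin k ((C : Set K) ∪ {x⁻¹})) =>
      (t : K)) hab
    exact ⟨1, by rw [Subtype.ext hab']⟩

/-- `C[x⁻¹]` is noetherian when `C` is (a localisation of a noetherian ring). [folklore] -/
theorem isNoetherianRing_adjoin_inv (C : Subalgebra k K) {x : K} (hx : x ∈ C) (hx0 : x ≠ 0)
    (hC : IsNoetherianRing ↥C) : IsNoetherianRing ↥(Algebra.adjoin k ((C : Set K) ∪ {x⁻¹})) := by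
  letI : Algebra ↥C ↥(Algebra.adjoin k ((C : Set K) ∪ {x⁻¹})) :=
    (Subalgebra.inclusion (le_adjoin_inv C x)).toRingHom.toAlgebra
  haveI := isLocalization_away_adjoin_inv C hx hx0
  exact IsLocalization.isNoetherianRing (Submonoid.powers (⟨x, hx⟩ : ↥C)) _ hC

/-- **`ca (B[x⁻¹]) = ⊤` for an annihilator `x`.** If `B` is noetherian and `0 ≠ x ∈ ca B` (image in
`K`), then the cohomology annihilator of `B[x⁻¹]` is the unit ideal: `x` remains an annihilator
in the localisation (Iyengar–Takahashi Lemma 2.10(1)) and is a unit there.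
[cite: IyengarTakahashi2014, Lemma 2.10(1)] -/
theorem cohomologyAnnihilator_adjoin_inv_eq_top (B : Subalgebra k K) {x : K}
    (hxca : x ∈ ((↑) : ↥B → K) '' (cohomologyAnnihilator ↥B : Set ↥B)) (hx0 : x ≠ 0)
    (hB : IsNoetherianRing ↥B) :
    cohomologyAnnihilator ↥(Algebra.adjoin k ((B : Set K) ∪ {x⁻¹})) = ⊤ := by
  obtain ⟨x', hx'ca, rfl⟩ := hxca
  haveI := hB
  letI : Algebra ↥B ↥(Algebra.adjoin k ((B : Set K) ∪ {((x' : K))⁻¹})) :=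
    (Subalgebra.inclusion (le_adjoin_inv B (x' : K))).toRingHom.toAlgebra
  haveI := isLocalization_away_adjoin_inv B x'.2 hx0
  have hmem : algebraMap ↥B ↥(Algebra.adjoin k ((B : Set K) ∪ {((x' : K))⁻¹})) x' ∈
      cohomologyAnnihilator ↥(Algebra.adjoin k ((B : Set K) ∪ {((x' : K))⁻¹})) :=
    algebraMap_mem_cohomologyAnnihilator_of_isLocalization
      (U := Submonoid.powers (⟨(x' : K), x'.2⟩ : ↥B)) _ hx'ca
  refine Ideal.eq_top_of_isUnit_mem _ hmem (IsUnit.of_mul_eq_one ⟨((x' : K))⁻¹,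
    inv_mem_adjoin_inv B (x' : K)⟩ (Subtype.ext ?_))
  change (x' : K) * ((x' : K))⁻¹ = 1
  exact mul_inv_cancel₀ hx0

/-- **`B[x⁻¹]` is integrally closed in `K`** (`B` noetherian, `Frac B = K`, `0 ≠ x ∈ ca B`):
`ca (B[x⁻¹]) = ⊤`, so `B[x⁻¹]` is regular at every prime and integrally closed in
`Frac (B[x⁻¹]) = K`; hence `nrm (B[x⁻¹]) = B[x⁻¹]`. [cite: Matsumura1987, Thm. 19.4] -/
theorem nrm_adjoin_inv_eq_self (B : Subalgebra k K) {x : K}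
    (hxca : x ∈ ((↑) : ↥B → K) '' (cohomologyAnnihilator ↥B : Set ↥B)) (hx0 : x ≠ 0)
    (hB : IsNoetherianRing ↥B) (hfrac : IsFractionRing ↥B K) :
    nrm (Algebra.adjoin k ((B : Set K) ∪ {x⁻¹})) = Algebra.adjoin k ((B : Set K) ∪ {x⁻¹}) := by
  have hxB : x ∈ B := by obtain ⟨x', -, rfl⟩ := hxca; exact x'.2
  haveI : IsNoetherianRing ↥(Algebra.adjoin k ((B : Set K) ∪ {x⁻¹})) :=
    isNoetherianRing_adjoin_inv B hxB hx0 hB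
  haveI := hfrac
  haveI : IsFractionRing ↥(Algebra.adjoin k ((B : Set K) ∪ {x⁻¹})) K :=
    isFractionRing_subalgebra_of_le B _ (le_adjoin_inv B x)
  haveI : IsIntegrallyClosed ↥(Algebra.adjoin k ((B : Set K) ∪ {x⁻¹})) :=
    isIntegrallyClosed_of_cohomologyAnnihilator_eq_top
      (cohomologyAnnihilator_adjoin_inv_eq_top B hxca hx0 hB)
  refine le_antisymm (fun y hy => ?_) (self_le_nrm _)
  obtain ⟨z, hz⟩ := (isIntegrallyClosed_iff K).mp inferInstance ((mem_nrm_iff _).mp hy)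
  rw [← hz]
  exact z.2

/-! ## Regular off `V(x)`: primes of `C` not containing `x` are primes of `C[x⁻¹]` -/

/-- **Regular off `V(x)`, abstract form.** If `x ∈ C`, `x ≠ 0`, and `C[x⁻¹]` is noetherian with
`ca (C[x⁻¹]) = ⊤`, then `C_Q` is a regular local ring for every prime `Q` of `C` not containing
`x`: `C_Q` is a localisation of `C[x⁻¹]` (the localisation of `C` away from `x`, and
`x ∉ Q`), so `ca (C_Q) = ⊤` (Lemma 2.10(1)) and `C_Q` is regular (Auslander–Buchsbaum–Serre).
[cite: IyengarTakahashi2014, Lemma 2.10] -/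
theorem isRegularLocalRing_localization_atPrime_of_adjoin_inv (C : Subalgebra k K) {x : K}
    (hxC : x ∈ C) (hx0 : x ≠ 0)
    (hLnoeth : IsNoetherianRing ↥(Algebra.adjoin k ((C : Set K) ∪ {x⁻¹})))
    (hLca : cohomologyAnnihilator ↥(Algebra.adjoin k ((C : Set K) ∪ {x⁻¹})) = ⊤)
    (Q : Ideal ↥C) [Q.IsPrime] (hxQ : (⟨x, hxC⟩ : ↥C) ∉ Q) :
    IsRegularLocalRing (Localization.AtPrime Q) := by
  letI : Algebra ↥C ↥(Algebra.adjoin k ((C : Set K) ∪ {x⁻¹})) :=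
    (Subalgebra.inclusion (le_adjoin_inv C x)).toRingHom.toAlgebra
  haveI hLaway : IsLocalization.Away (⟨x, hxC⟩ : ↥C) ↥(Algebra.adjoin k ((C : Set K) ∪ {x⁻¹})) :=
    isLocalization_away_adjoin_inv C hxC hx0
  have hle : Submonoid.powers (⟨x, hxC⟩ : ↥C) ≤ Q.primeCompl := by
    rintro _ ⟨n, rfl⟩
    exact fun h => hxQ (‹Q.IsPrime›.mem_of_pow_mem n h)
  -- `C_Q` as an algebra over `L = C[x⁻¹]` (no instance search on `SMul ↥L (C_Q)`: the scalar
  -- tower comes with the lemma's own instances)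
  letI instAlg : Algebra ↥(Algebra.adjoin k ((C : Set K) ∪ {x⁻¹})) (Localization.AtPrime Q) :=
    IsLocalization.localizationAlgebraOfSubmonoidLe ↥(Algebra.adjoin k ((C : Set K) ∪ {x⁻¹}))
      (Localization.AtPrime Q) (Submonoid.powers (⟨x, hxC⟩ : ↥C)) Q.primeCompl hle
  haveI instTower := IsLocalization.localization_isScalarTower_of_submonoid_le
    ↥(Algebra.adjoin k ((C : Set K) ∪ {x⁻¹})) (Localization.AtPrime Q)
    (Submonoid.powers (⟨x, hxC⟩ : ↥C)) Q.primeCompl hle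
  haveI hloc := IsLocalization.isLocalization_of_submonoid_le
    ↥(Algebra.adjoin k ((C : Set K) ∪ {x⁻¹})) (Localization.AtPrime Q)
    (Submonoid.powers (⟨x, hxC⟩ : ↥C)) Q.primeCompl hle
  haveI := hLnoeth
  haveI : IsNoetherianRing (Localization.AtPrime Q) :=
    IsLocalization.isNoetherianRing
      (Q.primeCompl.map (algebraMap ↥C ↥(Algebra.adjoin k ((C : Set K) ∪ {x⁻¹}))))
      (Localization.AtPrime Q) hLnoeth
  exact isRegularLocalRing_of_cohomologyAnnihilator_eq_top
    (cohomologyAnnihilator_eq_top_of_isLocalization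
      (Q.primeCompl.map (algebraMap ↥C ↥(Algebra.adjoin k ((C : Set K) ∪ {x⁻¹}))))
      (Localization.AtPrime Q) hLca)


end Summit.ResolutionOfSingularities.ResolutionOfSingularities.Theorems.HomologicalConductor.PersistenceAdjoinInv

end
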